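import Mathlib.Algebra.MvPolynomial.PDeriv
import Mathlib.Algebra.MvPolynomial.Funext
import Mathlib.Algebra.MvPolynomial.Monad
import Mathlib.RingTheory.Derivation.Basic
import Mathlib.Analysis.SpecialFunctions.ExpDeriv
import Mathlib.Analysis.Calculus.Deriv.Mul
import Mathlib.Analysis.Calculus.Deriv.Add
import Mathlib.Analysis.Calculus.IteratedDeriv.Lemmas
import Literature.NumberTheory.Transcendental.PhilipponZeroEstimate
import HarnessLib

/-!
# Philippon's zero estimate on `𝔾ₐ × 𝔾ₘ^m`: translations and invariant derivations

Topic `Literature/NumberTheory/Transcendental`. First module of the (inline, bottom-up) discharge of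
the named fact `Literature.NumberTheory.Transcendental.Philippon1986_GaGm`
(`PhilipponZeroEstimate.lean`; Philippon 1986, Théorème 2.1 for `G = 𝔾ₐ × 𝔾ₘ^m`), following the
affine reading of D. Roy's exposition (Nesterenko–Philippon (eds.), LNM 1752, Ch. 11, §3
"Translations and derivations"). For the linear group `G = 𝔾ₐ × 𝔾ₘ^m` everything in op. cit. §3 is
global and polynomial: the coordinate ring is `ℂ[X, Y₁, …, Y_m]` (`MvPolynomial (Fin (m+1)) ℂ`,
index `0` is `X`, index `j.succ` is `Y_j`, as in `GaGm.coord`), translations act by algebra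
endomorphisms, and the derivative along a one-parameter subgroup is an invariant derivation.
PROVED here (no named facts):

* `GaGm.transl g` — the translation `τ_g : P ↦ P(g · _)` as a `ℂ`-algebra endomorphism
  (`X ↦ X + g₀`, `Y_j ↦ g_j Y_j`), with `evalAt (transl g P) h = evalAt P (g * h)`
  (`GaGm.evalAt_transl`), `transl 1 = id`, `transl (g * g') = transl g' ∘ transl g`;
* `GaGm.invDeriv w` — the invariant derivation `D_w = w₀ ∂/∂X + ∑ⱼ vⱼ Yⱼ ∂/∂Yⱼ` attached to a
  tangent vector `w = (w₀, v) ∈ Lie G = ℂ × ℂ^m` (a `Derivation`, so Leibniz is free), linear in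
  `w`, with `D_w X = w₀`, `D_w Y_j = v_j Y_j`;
* `GaGm.flow z w t` — the curve `t ↦ (z₀ + t w₀, z_j e^{t v_j})` through ANY point `z ∈ ℂ^{m+1}`
  and **`GaGm.hasDerivAt_eval_flow`**: `d/dt P(flow z w t) = (D_w P)(flow z w t)` (Roy, Lemma 3.1
  made explicit), whence `GaGm.iteratedDeriv_eval_flow`:
  `d^k/dt^k P(flow z w t) = (D_w^k P)(flow z w t)`;
* `GaGm.coord_mul_exp_add_smul` — along the analytic subgroups of `PhilipponZeroEstimate.lean`,
  `coord (g · exp_G(v + t u)) = flow (coord (g · exp_G v)) u t`;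
* `GaGm.transl_invDeriv` — `τ_g ∘ D_w = D_w ∘ τ_g` (invariance; Roy (92)), proved by evaluating
  both sides along flows (`MvPolynomial.funext`).

Deliberately NOT here: the order of vanishing (`PhilipponZeroEstimateOrder.lean`), degree
bookkeeping, ideals.

## References

* Yu. V. Nesterenko, P. Philippon (eds.), *Introduction to Algebraic Independence Theory*,
  LNM 1752, Springer 2001, Ch. 11 (D. Roy), §3, Lemma 3.1, (92), Lemma 3.3 (pp. 171–173).
* P. Philippon, *Lemmes de zéros dans les groupes algébriques commutatifs*, Bull. Soc. Math.
  France 114 (1986), 355–383, §4.1.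
-/

noncomputable section

open MvPolynomial Complex

namespace Literature.NumberTheory.Transcendental

namespace GaGm

variable {m : ℕ}

/-! ### Translations -/

/-- The substitution defining the translation by `g = (g₀, (g_j))`: `X ↦ X + g₀`,
`Y_j ↦ g_j · Y_j`. [folklore] -/
def translSubst (g : GaGm m) : Fin (m + 1) → MvPolynomial (Fin (m + 1)) ℂ :=
  Fin.cons (X 0 + C (Multiplicative.toAdd g.1)) fun j => C ((g.2 j : ℂˣ) : ℂ) * X j.succ

/-- The translation operator `τ_g : P ↦ P(g · _)` on `ℂ[X, Y₁, …, Y_m]`, a `ℂ`-algebra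
endomorphism (Roy, LNM 1752 Ch. 11 §3.1: `f ↦ f ∘ τ_g`). [cite: NesterenkoPhilippon2001, Ch. 11 §3.1] -/
def transl (g : GaGm m) : MvPolynomial (Fin (m + 1)) ℂ →ₐ[ℂ] MvPolynomial (Fin (m + 1)) ℂ :=
  MvPolynomial.aeval (translSubst g)

/-- The `X`-component of the substitution. [folklore] -/
@[simp] theorem translSubst_zero (g : GaGm m) :
    translSubst g 0 = X 0 + C (Multiplicative.toAdd g.1) := by
  simp [translSubst]

/-- The `Y_j`-component of the substitution. [folklore] -/
@[simp] theorem translSubst_succ (g : GaGm m) (j : Fin m) :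
    translSubst g j.succ = C ((g.2 j : ℂˣ) : ℂ) * X j.succ := by
  simp [translSubst]

/-- `τ_g X = X + g₀`. [folklore] -/
@[simp] theorem transl_X_zero (g : GaGm m) :
    transl g (X 0) = X 0 + C (Multiplicative.toAdd g.1) := by
  simp [transl]

/-- `τ_g Y_j = g_j Y_j`. [folklore] -/
@[simp] theorem transl_X_succ (g : GaGm m) (j : Fin m) :
    transl g (X j.succ) = C ((g.2 j : ℂˣ) : ℂ) * X j.succ := by
  simp [transl]

/-- `τ_g` fixes constants. [folklore] -/
@[simp] theorem transl_C (g : GaGm m) (a : ℂ) : transl g (C a) = C a := by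
  simp [transl]

/-- Evaluation of a translate at an arbitrary point of `ℂ^{m+1}`:
`(τ_g P)(z) = P(z₀ + g₀, g_j z_j)`. [folklore] -/
theorem eval_transl (g : GaGm m) (P : MvPolynomial (Fin (m + 1)) ℂ) (z : Fin (m + 1) → ℂ) :
    eval z (transl g P) =
      eval (Fin.cons (z 0 + Multiplicative.toAdd g.1) fun j => ((g.2 j : ℂˣ) : ℂ) * z j.succ) P := by
  have h : eval z (transl g P) = eval (fun i => eval z (translSubst g i)) P :=
    eval₂Hom_bind₁ (RingHom.id ℂ) z (translSubst g) P
  rw [h]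
  have hfun : (fun i => eval z (translSubst g i)) =
      (Fin.cons (z 0 + Multiplicative.toAdd g.1) fun j => ((g.2 j : ℂˣ) : ℂ) * z j.succ) := by
    funext i
    refine Fin.cases ?_ (fun j => ?_) i <;> simp
  rw [hfun]

/-- The coordinates of a product: `coord (g h) = (g₀ + h₀, g_j h_j)`. [folklore] -/
theorem coord_mul (g h : GaGm m) :
    coord (g * h) = Fin.cons (Multiplicative.toAdd h.1 + Multiplicative.toAdd g.1)
      fun j => ((g.2 j : ℂˣ) : ℂ) * ((h.2 j : ℂˣ) : ℂ) := by
  funext i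
  refine Fin.cases ?_ (fun j => ?_) i <;> simp [toAdd_mul, add_comm]

/-- **Translation = composition with the group translation**: `(τ_g P)(h) = P(g · h)`.
[cite: NesterenkoPhilippon2001, Ch. 11 §3.1] -/
theorem evalAt_transl (g h : GaGm m) (P : MvPolynomial (Fin (m + 1)) ℂ) :
    evalAt (transl g P) h = evalAt P (g * h) := by
  rw [evalAt, evalAt, eval_transl, coord_mul]
  simp only [coord_zero, coord_succ]

/-- `τ_e = id`. [folklore] -/
theorem transl_one : transl (1 : GaGm m) = AlgHom.id ℂ _ := by
  refine MvPolynomial.algHom_ext fun i => ?_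
  refine Fin.cases ?_ (fun j => ?_) i <;> simp

/-- `τ_{g g'} = τ_{g'} ∘ τ_g` (the group is commutative, so also `= τ_g ∘ τ_{g'}`). [folklore] -/
theorem transl_mul (g g' : GaGm m) : transl (g * g') = (transl g').comp (transl g) := by
  refine MvPolynomial.algHom_ext fun i => ?_
  refine Fin.cases ?_ (fun j => ?_) i
  · simp only [transl_X_zero, AlgHom.comp_apply, map_add, transl_C, Prod.fst_mul, toAdd_mul,
      map_add]
    ring
  · simp only [transl_X_succ, AlgHom.comp_apply, map_mul, transl_C, Prod.snd_mul, Pi.mul_apply,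
      Units.val_mul, map_mul]
    ring

/-- `τ_g` is invertible with inverse `τ_{g⁻¹}`. [folklore] -/
theorem transl_inv_comp (g : GaGm m) : (transl g⁻¹).comp (transl g) = AlgHom.id ℂ _ := by
  rw [← transl_mul, mul_inv_cancel, transl_one]

/-- `τ_g` is injective. [folklore] -/
theorem transl_injective (g : GaGm m) : Function.Injective (transl g) := by
  intro P Q h
  have := congrArg (transl g⁻¹) h
  rwa [← AlgHom.comp_apply, ← AlgHom.comp_apply, transl_inv_comp, AlgHom.id_apply,
    AlgHom.id_apply] at this

/-- `τ_g` is surjective. [folklore] -/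
theorem transl_surjective (g : GaGm m) : Function.Surjective (transl g) := by
  intro Q
  refine ⟨transl g⁻¹ Q, ?_⟩
  have h := transl_inv_comp g⁻¹
  rw [inv_inv] at h
  rw [← AlgHom.comp_apply, h, AlgHom.id_apply]

/-! ### Invariant derivations -/

/-- The invariant derivation attached to the tangent vector `w = (w₀, v) ∈ Lie G = ℂ × ℂ^m`:
`D_w = w₀ ∂/∂X + ∑ⱼ vⱼ · Yⱼ ∂/∂Yⱼ`, i.e. `(D_w P)(h) = d/dt P(h · exp_G(t w))|_{t=0}`
(Roy, LNM 1752 Ch. 11, Lemma 3.1, for `G = 𝔾ₐ × 𝔾ₘ^m`). [cite: NesterenkoPhilippon2001, Ch. 11 Lemma 3.1] -/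
def invDeriv (w : ℂ × (Fin m → ℂ)) :
    Derivation ℂ (MvPolynomial (Fin (m + 1)) ℂ) (MvPolynomial (Fin (m + 1)) ℂ) :=
  w.1 • pderiv 0 + ∑ j : Fin m, w.2 j • ((X j.succ : MvPolynomial (Fin (m + 1)) ℂ) • pderiv j.succ)

/-- Pointwise evaluation of a finite sum of derivations. [folklore] -/
theorem sum_derivation_apply {ι : Type*} (s : Finset ι)
    (D : ι → Derivation ℂ (MvPolynomial (Fin (m + 1)) ℂ) (MvPolynomial (Fin (m + 1)) ℂ))
    (P : MvPolynomial (Fin (m + 1)) ℂ) : (∑ j ∈ s, D j) P = ∑ j ∈ s, D j P := by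
  classical
  induction s using Finset.induction_on with
  | empty => simp
  | insert a s ha ih => rw [Finset.sum_insert ha, Finset.sum_insert ha, Derivation.add_apply, ih]

/-- The formula `D_w P = w₀ ∂P/∂X + ∑ⱼ vⱼ Yⱼ ∂P/∂Yⱼ`. [folklore] -/
theorem invDeriv_apply (w : ℂ × (Fin m → ℂ)) (P : MvPolynomial (Fin (m + 1)) ℂ) :
    invDeriv w P = w.1 • pderiv 0 P + ∑ j : Fin m, w.2 j • (X j.succ * pderiv j.succ P) := by
  simp only [invDeriv, Derivation.add_apply, Derivation.smul_apply, sum_derivation_apply,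
    smul_eq_mul]

/-- `D_w X = w₀` (a constant). [folklore] -/
@[simp] theorem invDeriv_X_zero (w : ℂ × (Fin m → ℂ)) :
    invDeriv w (X 0 : MvPolynomial (Fin (m + 1)) ℂ) = C w.1 := by
  rw [invDeriv_apply]
  simp [pderiv_X, Fin.succ_ne_zero, MvPolynomial.smul_eq_C_mul]

/-- `D_w Y_j = v_j Y_j`. [folklore] -/
@[simp] theorem invDeriv_X_succ (w : ℂ × (Fin m → ℂ)) (j : Fin m) :
    invDeriv w (X j.succ : MvPolynomial (Fin (m + 1)) ℂ) = C (w.2 j) * X j.succ := by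
  rw [invDeriv_apply]
  have h0 : pderiv 0 (X j.succ : MvPolynomial (Fin (m + 1)) ℂ) = 0 := by
    rw [pderiv_X]
    simp [Fin.succ_ne_zero]
  have h1 : ∀ b : Fin m, pderiv b.succ (X j.succ : MvPolynomial (Fin (m + 1)) ℂ) =
      if b = j then 1 else 0 := fun b => by
    rw [pderiv_X]
    simp [Pi.single_apply, Fin.succ_inj, eq_comm]
  rw [h0, smul_zero, zero_add]
  simp_rw [h1, mul_ite, mul_one, mul_zero, smul_ite, smul_zero]
  rw [Finset.sum_ite_eq' Finset.univ j]
  simp [MvPolynomial.smul_eq_C_mul]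

/-- `D_w` kills constants. [folklore] -/
@[simp] theorem invDeriv_C (w : ℂ × (Fin m → ℂ)) (a : ℂ) :
    invDeriv w (C a : MvPolynomial (Fin (m + 1)) ℂ) = 0 := by
  rw [← MvPolynomial.algebraMap_eq]
  exact (invDeriv w).map_algebraMap a

/-- `w ↦ D_w` is additive. [folklore] -/
theorem invDeriv_add (w w' : ℂ × (Fin m → ℂ)) :
    invDeriv (m := m) (w + w') = invDeriv w + invDeriv w' := by
  ext P : 1
  simp only [invDeriv_apply, Derivation.add_apply, Prod.fst_add, Prod.snd_add, Pi.add_apply,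
    add_smul, Finset.sum_add_distrib]
  abel

/-- `w ↦ D_w` is homogeneous. [folklore] -/
theorem invDeriv_smul (c : ℂ) (w : ℂ × (Fin m → ℂ)) :
    invDeriv (m := m) (c • w) = c • invDeriv w := by
  ext P : 1
  simp only [invDeriv_apply, Derivation.smul_apply, Prod.smul_fst, Prod.smul_snd, Pi.smul_apply,
    smul_eq_mul, mul_smul, Finset.smul_sum, smul_add]

/-! ### Flows: the one-parameter subgroups through an arbitrary point of `ℂ^{m+1}` -/

/-- The curve `t ↦ (z₀ + t w₀, z₁ e^{t v₁}, …, z_m e^{t v_m})` — the orbit of the point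
`z ∈ ℂ^{m+1}` under the one-parameter subgroup `t ↦ exp_G(t w)` (also for `z` outside `G`).
[folklore] -/
def flow (z : Fin (m + 1) → ℂ) (w : ℂ × (Fin m → ℂ)) (t : ℂ) : Fin (m + 1) → ℂ :=
  Fin.cons (z 0 + t * w.1) fun j => z j.succ * Complex.exp (t * w.2 j)

/-- The additive coordinate of the flow. [folklore] -/
@[simp] theorem flow_apply_zero (z : Fin (m + 1) → ℂ) (w : ℂ × (Fin m → ℂ)) (t : ℂ) :
    flow z w t 0 = z 0 + t * w.1 := by
  simp [flow]

/-- The multiplicative coordinates of the flow. [folklore] -/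
@[simp] theorem flow_apply_succ (z : Fin (m + 1) → ℂ) (w : ℂ × (Fin m → ℂ)) (t : ℂ)
    (j : Fin m) : flow z w t j.succ = z j.succ * Complex.exp (t * w.2 j) := by
  simp [flow]

/-- At `t = 0` the flow is at `z`. [folklore] -/
@[simp] theorem flow_zero (z : Fin (m + 1) → ℂ) (w : ℂ × (Fin m → ℂ)) : flow z w 0 = z := by
  funext i
  refine Fin.cases ?_ (fun j => ?_) i <;> simp

/-- Derivative of the additive coordinate of the flow. [folklore] -/
theorem hasDerivAt_flow_zero (z : Fin (m + 1) → ℂ) (w : ℂ × (Fin m → ℂ)) (t : ℂ) :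
    HasDerivAt (fun s => flow z w s 0) w.1 t := by
  simp only [flow_apply_zero]
  have h := ((hasDerivAt_id' t).mul_const w.1).const_add (z 0)
  rw [one_mul] at h
  exact h

/-- Derivative of a multiplicative coordinate of the flow. [folklore] -/
theorem hasDerivAt_flow_succ (z : Fin (m + 1) → ℂ) (w : ℂ × (Fin m → ℂ)) (t : ℂ) (j : Fin m) :
    HasDerivAt (fun s => flow z w s j.succ) (w.2 j * flow z w t j.succ) t := by
  simp only [flow_apply_succ]
  have h1 : HasDerivAt (fun s : ℂ => s * w.2 j) (w.2 j) t := by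
    have h := (hasDerivAt_id' t).mul_const (w.2 j)
    rwa [one_mul] at h
  have h3 := (h1.cexp).const_mul (z j.succ)
  exact h3.congr_deriv (by ring)

/-- **Derivative along the flow = invariant derivation** (Roy, LNM 1752 Ch. 11, Lemma 3.1, explicit
for `𝔾ₐ × 𝔾ₘ^m`): `d/dt P(flow z w t) = (D_w P)(flow z w t)` for every `P`, `z`, `w`, `t`.
[cite: NesterenkoPhilippon2001, Ch. 11 Lemma 3.1] -/
theorem hasDerivAt_eval_flow (P : MvPolynomial (Fin (m + 1)) ℂ) (z : Fin (m + 1) → ℂ)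
    (w : ℂ × (Fin m → ℂ)) (t : ℂ) :
    HasDerivAt (fun s => eval (flow z w s) P) (eval (flow z w t) (invDeriv w P)) t := by
  induction P using MvPolynomial.induction_on with
  | C a =>
    simp only [eval_C, invDeriv_C, map_zero]
    exact hasDerivAt_const t a
  | add p q hp hq =>
    simp only [map_add]
    exact hp.add hq
  | mul_X p i hp =>
    have key : ∀ s, eval (flow z w s) (p * X i) = eval (flow z w s) p * flow z w s i := fun s => by
      simp only [map_mul, eval_X]
    simp_rw [key]
    simp only [Derivation.leibniz, smul_eq_mul, map_add, map_mul, eval_X]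
    revert key
    refine Fin.cases ?_ (fun j => ?_) i
    · intro _
      simp only [invDeriv_X_zero, eval_C]
      exact (hp.mul (hasDerivAt_flow_zero z w t)).congr_deriv (by ring)
    · intro _
      simp only [invDeriv_X_succ, map_mul, eval_C, eval_X]
      exact (hp.mul (hasDerivAt_flow_succ z w t j)).congr_deriv (by ring)

/-- `deriv` form of `hasDerivAt_eval_flow`. [folklore] -/
theorem deriv_eval_flow (P : MvPolynomial (Fin (m + 1)) ℂ) (z : Fin (m + 1) → ℂ)
    (w : ℂ × (Fin m → ℂ)) :
    deriv (fun s => eval (flow z w s) P) = fun t => eval (flow z w t) (invDeriv w P) :=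
  funext fun t => (hasDerivAt_eval_flow P z w t).deriv

/-- **Iterated derivatives along the flow**: `d^k/dt^k P(flow z w t) = (D_w^k P)(flow z w t)`.
[cite: NesterenkoPhilippon2001, Ch. 11 Lemma 3.3] -/
theorem iteratedDeriv_eval_flow (k : ℕ) (P : MvPolynomial (Fin (m + 1)) ℂ)
    (z : Fin (m + 1) → ℂ) (w : ℂ × (Fin m → ℂ)) (t : ℂ) :
    iteratedDeriv k (fun s => eval (flow z w s) P) t = eval (flow z w t) ((invDeriv w)^[k] P) := by
  induction k generalizing P t with
  | zero => simp
  | succ k ih =>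
    rw [iteratedDeriv_succ', Function.iterate_succ_apply]
    rw [deriv_eval_flow]
    exact ih (invDeriv w P) t

/-- In particular `(D_w P)(z) = d/dt P(flow z w t)|_{t=0}` at every point `z ∈ ℂ^{m+1}`.
[folklore] -/
theorem eval_invDeriv_eq_deriv (P : MvPolynomial (Fin (m + 1)) ℂ) (z : Fin (m + 1) → ℂ)
    (w : ℂ × (Fin m → ℂ)) :
    eval z (invDeriv w P) = deriv (fun s => eval (flow z w s) P) 0 := by
  rw [deriv_eval_flow]
  simp only [flow_zero]

/-! ### Flows and the analytic subgroups `exp_G(W)`; invariance under translations -/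

/-- Along the analytic subgroups: `coord (g · exp_G(v + t u)) = flow (coord (g · exp_G v)) u t`.
[folklore] -/
theorem coord_mul_exp_add_smul (g : GaGm m) (v u : ℂ × (Fin m → ℂ)) (t : ℂ) :
    coord (g * exp (v + t • u)) = flow (coord (g * exp v)) u t := by
  funext i
  refine Fin.cases ?_ (fun j => ?_) i
  · simp only [coord_zero, Prod.fst_mul, toAdd_mul, flow_apply_zero, exp, toAdd_ofAdd,
      Prod.fst_add, Prod.smul_fst, smul_eq_mul]
    ring
  · simp only [coord_succ, Prod.snd_mul, Pi.mul_apply, Units.val_mul, flow_apply_succ, exp,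
      Units.val_mk0, Prod.snd_add, Pi.add_apply, Prod.smul_snd, Pi.smul_apply, smul_eq_mul,
      Complex.exp_add]
    ring

/-- The flow through a translated point is the translate of the flow:
`(z₀ + t w₀ + g₀, g_j z_j e^{t v_j})`. [folklore] -/
theorem flow_transl (g : GaGm m) (z : Fin (m + 1) → ℂ) (w : ℂ × (Fin m → ℂ)) (t : ℂ) :
    (Fin.cons (flow z w t 0 + Multiplicative.toAdd g.1)
        (fun j => ((g.2 j : ℂˣ) : ℂ) * flow z w t j.succ) : Fin (m + 1) → ℂ) =
      flow (Fin.cons (z 0 + Multiplicative.toAdd g.1) fun j => ((g.2 j : ℂˣ) : ℂ) * z j.succ) w t := by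
  funext i
  refine Fin.cases ?_ (fun j => ?_) i
  · simp only [Fin.cons_zero, flow_apply_zero]
    ring
  · simp only [Fin.cons_succ, flow_apply_succ]
    ring

/-- **Invariance of `D_w` under translations** (Roy (92): `∂(f ∘ τ_σ) = (∂f) ∘ τ_σ`):
`τ_g (D_w P) = D_w (τ_g P)`. [cite: NesterenkoPhilippon2001, Ch. 11 (92)] -/
theorem transl_invDeriv (g : GaGm m) (w : ℂ × (Fin m → ℂ)) (P : MvPolynomial (Fin (m + 1)) ℂ) :
    transl g (invDeriv w P) = invDeriv w (transl g P) := by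
  apply MvPolynomial.funext
  intro z
  rw [eval_transl, eval_invDeriv_eq_deriv, eval_invDeriv_eq_deriv]
  congr 1
  funext s
  rw [eval_transl, flow_transl]

/-- Iterated form: `τ_g (D_w^k P) = D_w^k (τ_g P)`. [folklore] -/
theorem transl_invDeriv_iterate (g : GaGm m) (w : ℂ × (Fin m → ℂ)) (k : ℕ)
    (P : MvPolynomial (Fin (m + 1)) ℂ) :
    transl g ((invDeriv w)^[k] P) = (invDeriv w)^[k] (transl g P) := by
  induction k generalizing P with
  | zero => rfl
  | succ k ih =>
    rw [Function.iterate_succ_apply, Function.iterate_succ_apply, ih, transl_invDeriv]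

/-- Evaluation form of invariance: `(D_w^k P)(g h) = (D_w^k (τ_g P))(h)`. [folklore] -/
theorem evalAt_invDeriv_iterate_mul (g h : GaGm m) (w : ℂ × (Fin m → ℂ)) (k : ℕ)
    (P : MvPolynomial (Fin (m + 1)) ℂ) :
    evalAt ((invDeriv w)^[k] P) (g * h) = evalAt ((invDeriv w)^[k] (transl g P)) h := by
  rw [← evalAt_transl, transl_invDeriv_iterate]

end GaGm

end Literature.NumberTheory.Transcendental
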